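import Summits.HodgeConjecture.HodgeConjecture.Theses.EightfoldBlochSeeds
import Summits.HodgeConjecture.HodgeConjecture.Theorems.FirstOrderSemiregularSeedsFirstOrderWeilSeedsEightCPad4Anchor
import HarnessLib

/-!
# Route `EightfoldBlochSeeds`, cruxes `BlochSeedDiscThree` (item stmt-HodgeConjecture-18882) / `BlochSeedsGeneric` (18880) /
# `BlochSeedDiscOne` (18881), line `pad4-cm-anchor` (`Cruxes/BlochSeedDiscThree/Lines/pad4_cm_anchor.lean` d208bf462bd6e07f,
# `Cruxes/BlochSeedsGeneric/Lines/pad4_cm_anchor.lean` fb115e60acaf2337), stub `stub_rung_pad4_seedAt`: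
# ONE CM ANCHOR SUFFICES — the cruxes BY NAME from seed data on a single PAD-4 anchor `S⁴(E₀)`

HONEST FRAMING. Nothing here proves the stub, any of the three cruxes, rung H2, HC_AV or the Hodge conjecture; nothing is
constructed. UNCONDITIONAL door algebra only (every theorem carries the seed data as hypotheses); no named fact is taken as a
hypothesis, no definition and no Literature fact is introduced (D-0026). Census-neutral.

WHAT IS HERE (leafhand `leafhand-hodge-eightfoldblochseed-1-g0`). The registered rung stub of the `pad4-cm-anchor` lines is
UNIVERSALLY quantified over the CM datum: `∀ (E₀, ψ₀)`, `dim E₀ = 1`, `ψ₀ ≫ ψ₀ = -d`, a hyperbolic Bloch seed on `S⁴(E₀)`. The cruxes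
are EXISTENTIAL in the eightfold (`HasHyperbolicBlochSeed 4 d = ∃ P ψ₀ e a w, …`). For a general discriminant `d` the universal
form is STRICTLY more demanding than the crux needs: the complex elliptic curves carrying an endomorphism of square `-d` are the
`ℂ/𝔞` for `𝔞` a proper fractional ideal of an order `𝒪 ⊇ ℤ[√-d]` of `ℚ(√-d)` — several non-isomorphic anchors as soon as a class
number `h(𝒪) > 1` occurs (e.g. `d = 5`: `ℂ/ℤ[√-5]` and `ℂ/(2, 1+√-5)`), and no transport of seeds between non-isomorphic anchors
is available (nor expected). This file records the introduction rules that a designer working on ONE anchor actually needs: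

* §1 `hasHyperbolicBlochSeed_four_of_pad4Seed` — ONE CM datum `(E₀, ψ₀)` (`dim E₀ = 1`, `ψ₀² = -d`, `d ≥ 1`), a projective
  embedding `e` of `S⁴ = ((S × S) × S) × S`, `S = E₀ × E₀`, a rational `a ≠ 0` with `(S⁴, Ψ)`, `Ψ = (ψ₀ × (−ψ₀))⁴` (the skeletons'
  `pad4Action E₀ ψ₀`, a binder here, discharged by `rfl`), HYPERBOLIC in half-dimension `4` for `h_K = d·e^*a + Ψ^*e^*a`, a non-zero
  rational class `w` of the Weil plane and a Bloch seed for `q·h_K⁴ + w` give `HasHyperbolicBlochSeed 4 d`; `dim S⁴ = 8` and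
  `Ψ² = -d` are the tree's (`Theorems.pad4Anchor_hyperbolic_weilClass`, route `FirstOrderSemiregularSeeds`).
* §2 THE CRUXES BY NAME from one anchor: `blochSeedDiscThree_of_pad4Seed` (`d = 3`, item 18882), `blochSeedDiscOne_of_pad4Seed`
  (`d = 1`, item 18881), `blochSeedsGeneric_of_pad4Seeds` (one anchor PER `d ∉ {1, 3}`, item 18880) — conclusions
  `Theses.EightfoldBlochSeeds.BlochSeedDiscThree / BlochSeedDiscOne / BlochSeedsGeneric` (the copies in
  `Theses.EightfoldTwistedSheafSeeds` have the same bodies, so the same terms prove them).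
* §3 `exists_pad4_anchorData` — the anchor half of §1's hypotheses is INHABITED for every `d` and every CM datum: `e`, rational
  `a ≠ 0`, hyperbolicity for `h_K`, and a non-zero rational Weil class of type `(4,4)` (re-export of `pad4Anchor_hyperbolic_weilClass`
  in the door's binder order), so that §1/§2 ask the designer for exactly ONE thing: `HasBlochSeedAt 4 S⁴ h_K w` for an `(e, a, w)` of
  their choosing (the minimal-clause and `K`-symmetrisation bridges for that clause are in
  `Theorems/EightfoldBlochSeedsBlochSeedsGenericPad4SeedMinimalClauses.lean`).

WHAT IS NOT HERE = the seed: an integral lci fourfold `Z ⊂ S⁴(E₀)`, Bloch-semiregular, carrying `q·h_K⁴ + w`, `w ≠ 0` — for no `d`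
in print ([Markman2025SecantWeil] §1.5; Bloch 1972 Remark (7.5)).

## References

[cite: Bloch1972Semiregularity, Thm. (7.4) and Remark (7.5)] [cite: Markman2025SecantWeil, §1.5]
[cite: Markman2025SurveySecant, §11.5 Step 2] [cite: vanGeemen1994HodgeAV, Lemma 5.2, 5.3 and 5.4 (5.4.1)]
[cite: SilvermanAEC2009, Thm. VI.4.1 (b)] [cite: Cox2013PrimesOfTheForm, Thm. 7.7 and Cor. 10.20]
-/

noncomputable section

-- single-problem summit (Problem = Summit): the mandated namespace repeats `HodgeConjecture`.
set_option linter.dupNamespace false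

open CategoryTheory AlgebraicGeometry
open Literature.AlgebraicGeometry Literature.AlgebraicGeometry.Motives Literature.AlgebraicGeometry.HodgeTheory
open Literature.AlgebraicTopology.SingularHomology

namespace Summit.HodgeConjecture.HodgeConjecture.Theorems

/-! ## §1 One CM anchor suffices for `HasHyperbolicBlochSeed 4 d` -/

section OneAnchor

variable {d : ℕ} {E₀ : AbelianVariety ℂ} {ψ₀ : E₀ ⟶ E₀}

/-- **A hyperbolic Bloch seed on ONE PAD-4 CM anchor gives `HasHyperbolicBlochSeed 4 d`.** For a CM datum `(E₀, ψ₀)` with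
`dim E₀ = 1`, `ψ₀ ≫ ψ₀ = -d`, `d ≥ 1`, the nested action `Ψ = (ψ₀ × (−ψ₀))⁴` on `S⁴ = ((S × S) × S) × S`, `S = E₀ × E₀` (the skeletons'
`pad4Action E₀ ψ₀`; instantiate `hΨ` by `rfl`), a projective embedding `e` with a rational `a ≠ 0` making `(S⁴, Ψ)` hyperbolic in
half-dimension `4` for `h_K = d·e^*a + Ψ^*e^*a`, a non-zero rational class `w` of the Weil plane and a Bloch seed for `q·h_K⁴ + w`:
then `HasHyperbolicBlochSeed 4 d` (`dim S⁴ = 2·4` and `Ψ ≫ Ψ = -d` from the tree's `pad4Anchor_hyperbolic_weilClass`).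
[cite: Bloch1972Semiregularity, Remark (7.5)] [cite: Markman2025SecantWeil, §1.5] -/
theorem hasHyperbolicBlochSeed_four_of_pad4Seed (hd : 0 < d) (hE : E₀.dim = 1) (hψ : ψ₀ ≫ ψ₀ = -(d • 𝟙 E₀))
    (Ψ : (((E₀.prod E₀).prod (E₀.prod E₀)).prod (E₀.prod E₀)).prod (E₀.prod E₀) ⟶
      (((E₀.prod E₀).prod (E₀.prod E₀)).prod (E₀.prod E₀)).prod (E₀.prod E₀))
    (hΨ : Ψ = AbelianVariety.prodLift
        (AbelianVariety.fst (((E₀.prod E₀).prod (E₀.prod E₀)).prod (E₀.prod E₀)) (E₀.prod E₀) ≫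
          AbelianVariety.prodLift
            (AbelianVariety.fst ((E₀.prod E₀).prod (E₀.prod E₀)) (E₀.prod E₀) ≫
              AbelianVariety.prodLift
                (AbelianVariety.fst (E₀.prod E₀) (E₀.prod E₀) ≫
                  AbelianVariety.prodLift (AbelianVariety.fst E₀ E₀ ≫ ψ₀) (AbelianVariety.snd E₀ E₀ ≫ (-ψ₀)))
                (AbelianVariety.snd (E₀.prod E₀) (E₀.prod E₀) ≫
                  AbelianVariety.prodLift (AbelianVariety.fst E₀ E₀ ≫ ψ₀) (AbelianVariety.snd E₀ E₀ ≫ (-ψ₀))))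
            (AbelianVariety.snd ((E₀.prod E₀).prod (E₀.prod E₀)) (E₀.prod E₀) ≫
              AbelianVariety.prodLift (AbelianVariety.fst E₀ E₀ ≫ ψ₀) (AbelianVariety.snd E₀ E₀ ≫ (-ψ₀))))
        (AbelianVariety.snd (((E₀.prod E₀).prod (E₀.prod E₀)).prod (E₀.prod E₀)) (E₀.prod E₀) ≫
          AbelianVariety.prodLift (AbelianVariety.fst E₀ E₀ ≫ ψ₀) (AbelianVariety.snd E₀ E₀ ≫ (-ψ₀))))
    (e : ProjectiveEmbedding ((((E₀.prod E₀).prod (E₀.prod E₀)).prod (E₀.prod E₀)).prod (E₀.prod E₀)).X)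
    (a : complexBetti (projectiveSpace e.n ℂ) 2) (ha : IsRationalClass a) (ha0 : a ≠ 0)
    (hhyp : IsHyperbolicWeilType _ Ψ 4
      ((d : ℂ) • complexBetti.map e.ι 2 a + complexBetti.map Ψ.hom.hom.hom 2 (complexBetti.map e.ι 2 a)))
    (w : complexBetti ((((E₀.prod E₀).prod (E₀.prod E₀)).prod (E₀.prod E₀)).prod (E₀.prod E₀)).X (2 * 4))
    (hwW : w ∈ weilClassesOf _ Ψ 4 d) (hwr : IsRationalClass w) (hw0 : w ≠ 0)
    (hseed : HasBlochSeedAt 4 ((((E₀.prod E₀).prod (E₀.prod E₀)).prod (E₀.prod E₀)).prod (E₀.prod E₀))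
      ((d : ℂ) • complexBetti.map e.ι 2 a + complexBetti.map Ψ.hom.hom.hom 2 (complexBetti.map e.ι 2 a)) w) :
    HasHyperbolicBlochSeed 4 d := by
  obtain ⟨hdim, hsq, -, -⟩ := pad4Anchor_hyperbolic_weilClass hE hd hψ Ψ hΨ
  exact ⟨_, Ψ, e, a, w, hdim, hsq, ha, ha0, hhyp, hwW, hwr, hw0, hseed⟩

end OneAnchor

/-! ## §2 The cruxes by name from one anchor -/

section ByName

open Summit.HodgeConjecture.HodgeConjecture.Theses.EightfoldBlochSeeds

/-- **`BlochSeedDiscThree` (item stmt-HodgeConjecture-18882) from a hyperbolic Bloch seed on ONE PAD-4 anchor of discriminant `3`**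
(any CM datum `(E₀, ψ₀)` with `ψ₀² = -3`: `ℂ/ℤ[ζ₃]` with `√-3 = 1 + 2ζ₃`, or `ℂ/ℤ[√-3]`). [cite: Bloch1972Semiregularity, Remark (7.5)]
[cite: Schoen1988HodgeWeil, §3] -/
theorem blochSeedDiscThree_of_pad4Seed {E₀ : AbelianVariety ℂ} {ψ₀ : E₀ ⟶ E₀} (hE : E₀.dim = 1)
    (hψ : ψ₀ ≫ ψ₀ = -((3 : ℕ) • 𝟙 E₀))
    (Ψ : (((E₀.prod E₀).prod (E₀.prod E₀)).prod (E₀.prod E₀)).prod (E₀.prod E₀) ⟶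
      (((E₀.prod E₀).prod (E₀.prod E₀)).prod (E₀.prod E₀)).prod (E₀.prod E₀))
    (hΨ : Ψ = AbelianVariety.prodLift
        (AbelianVariety.fst (((E₀.prod E₀).prod (E₀.prod E₀)).prod (E₀.prod E₀)) (E₀.prod E₀) ≫
          AbelianVariety.prodLift
            (AbelianVariety.fst ((E₀.prod E₀).prod (E₀.prod E₀)) (E₀.prod E₀) ≫
              AbelianVariety.prodLift
                (AbelianVariety.fst (E₀.prod E₀) (E₀.prod E₀) ≫
                  AbelianVariety.prodLift (AbelianVariety.fst E₀ E₀ ≫ ψ₀) (AbelianVariety.snd E₀ E₀ ≫ (-ψ₀)))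
                (AbelianVariety.snd (E₀.prod E₀) (E₀.prod E₀) ≫
                  AbelianVariety.prodLift (AbelianVariety.fst E₀ E₀ ≫ ψ₀) (AbelianVariety.snd E₀ E₀ ≫ (-ψ₀))))
            (AbelianVariety.snd ((E₀.prod E₀).prod (E₀.prod E₀)) (E₀.prod E₀) ≫
              AbelianVariety.prodLift (AbelianVariety.fst E₀ E₀ ≫ ψ₀) (AbelianVariety.snd E₀ E₀ ≫ (-ψ₀))))
        (AbelianVariety.snd (((E₀.prod E₀).prod (E₀.prod E₀)).prod (E₀.prod E₀)) (E₀.prod E₀) ≫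
          AbelianVariety.prodLift (AbelianVariety.fst E₀ E₀ ≫ ψ₀) (AbelianVariety.snd E₀ E₀ ≫ (-ψ₀))))
    (e : ProjectiveEmbedding ((((E₀.prod E₀).prod (E₀.prod E₀)).prod (E₀.prod E₀)).prod (E₀.prod E₀)).X)
    (a : complexBetti (projectiveSpace e.n ℂ) 2) (ha : IsRationalClass a) (ha0 : a ≠ 0)
    (hhyp : IsHyperbolicWeilType _ Ψ 4
      (((3 : ℕ) : ℂ) • complexBetti.map e.ι 2 a + complexBetti.map Ψ.hom.hom.hom 2 (complexBetti.map e.ι 2 a)))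
    (w : complexBetti ((((E₀.prod E₀).prod (E₀.prod E₀)).prod (E₀.prod E₀)).prod (E₀.prod E₀)).X (2 * 4))
    (hwW : w ∈ weilClassesOf _ Ψ 4 3) (hwr : IsRationalClass w) (hw0 : w ≠ 0)
    (hseed : HasBlochSeedAt 4 ((((E₀.prod E₀).prod (E₀.prod E₀)).prod (E₀.prod E₀)).prod (E₀.prod E₀))
      (((3 : ℕ) : ℂ) • complexBetti.map e.ι 2 a + complexBetti.map Ψ.hom.hom.hom 2 (complexBetti.map e.ι 2 a)) w) :
    BlochSeedDiscThree :=
  hasHyperbolicBlochSeed_four_of_pad4Seed (d := 3) (by norm_num) hE hψ Ψ hΨ e a ha ha0 hhyp w hwW hwr hw0 hseed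

/-- **`BlochSeedDiscOne` (item stmt-HodgeConjecture-18881) from a hyperbolic Bloch seed on THE PAD-4 anchor of discriminant `1`**
(`E₀ = ℂ/ℤ[i]`, `ψ₀ = ±[i]`; the crux workfiles' `blochSeedDiscOne_of_…_one` doors, v11 §14.1, in citable form).
[cite: Bloch1972Semiregularity, Remark (7.5)] [cite: Koike2004WeilHodge, §1] -/
theorem blochSeedDiscOne_of_pad4Seed {E₀ : AbelianVariety ℂ} {ψ₀ : E₀ ⟶ E₀} (hE : E₀.dim = 1)
    (hψ : ψ₀ ≫ ψ₀ = -((1 : ℕ) • 𝟙 E₀))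
    (Ψ : (((E₀.prod E₀).prod (E₀.prod E₀)).prod (E₀.prod E₀)).prod (E₀.prod E₀) ⟶
      (((E₀.prod E₀).prod (E₀.prod E₀)).prod (E₀.prod E₀)).prod (E₀.prod E₀))
    (hΨ : Ψ = AbelianVariety.prodLift
        (AbelianVariety.fst (((E₀.prod E₀).prod (E₀.prod E₀)).prod (E₀.prod E₀)) (E₀.prod E₀) ≫
          AbelianVariety.prodLift
            (AbelianVariety.fst ((E₀.prod E₀).prod (E₀.prod E₀)) (E₀.prod E₀) ≫
              AbelianVariety.prodLift
                (AbelianVariety.fst (E₀.prod E₀) (E₀.prod E₀) ≫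
                  AbelianVariety.prodLift (AbelianVariety.fst E₀ E₀ ≫ ψ₀) (AbelianVariety.snd E₀ E₀ ≫ (-ψ₀)))
                (AbelianVariety.snd (E₀.prod E₀) (E₀.prod E₀) ≫
                  AbelianVariety.prodLift (AbelianVariety.fst E₀ E₀ ≫ ψ₀) (AbelianVariety.snd E₀ E₀ ≫ (-ψ₀))))
            (AbelianVariety.snd ((E₀.prod E₀).prod (E₀.prod E₀)) (E₀.prod E₀) ≫
              AbelianVariety.prodLift (AbelianVariety.fst E₀ E₀ ≫ ψ₀) (AbelianVariety.snd E₀ E₀ ≫ (-ψ₀))))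
        (AbelianVariety.snd (((E₀.prod E₀).prod (E₀.prod E₀)).prod (E₀.prod E₀)) (E₀.prod E₀) ≫
          AbelianVariety.prodLift (AbelianVariety.fst E₀ E₀ ≫ ψ₀) (AbelianVariety.snd E₀ E₀ ≫ (-ψ₀))))
    (e : ProjectiveEmbedding ((((E₀.prod E₀).prod (E₀.prod E₀)).prod (E₀.prod E₀)).prod (E₀.prod E₀)).X)
    (a : complexBetti (projectiveSpace e.n ℂ) 2) (ha : IsRationalClass a) (ha0 : a ≠ 0)
    (hhyp : IsHyperbolicWeilType _ Ψ 4
      (((1 : ℕ) : ℂ) • complexBetti.map e.ι 2 a + complexBetti.map Ψ.hom.hom.hom 2 (complexBetti.map e.ι 2 a)))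
    (w : complexBetti ((((E₀.prod E₀).prod (E₀.prod E₀)).prod (E₀.prod E₀)).prod (E₀.prod E₀)).X (2 * 4))
    (hwW : w ∈ weilClassesOf _ Ψ 4 1) (hwr : IsRationalClass w) (hw0 : w ≠ 0)
    (hseed : HasBlochSeedAt 4 ((((E₀.prod E₀).prod (E₀.prod E₀)).prod (E₀.prod E₀)).prod (E₀.prod E₀))
      (((1 : ℕ) : ℂ) • complexBetti.map e.ι 2 a + complexBetti.map Ψ.hom.hom.hom 2 (complexBetti.map e.ι 2 a)) w) :
    BlochSeedDiscOne :=
  hasHyperbolicBlochSeed_four_of_pad4Seed (d := 1) one_pos hE hψ Ψ hΨ e a ha ha0 hhyp w hwW hwr hw0 hseed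

/-- **`BlochSeedsGeneric` (item stmt-HodgeConjecture-18880) from ONE hyperbolic Bloch seed per discriminant `d ∉ {1, 3}`, each on a
PAD-4 anchor of the designer's choosing** — the stub `stub_rung_pad4_seedAt` asks for a seed on EVERY CM anchor `(E₀, ψ₀)` with
`ψ₀² = -d`; the crux needs one. The nested action `Ψ = (ψ₀ × (−ψ₀))⁴` is a bound variable with its defining equation (the
skeleton's `pad4Action E₀ ψ₀`, by `rfl`).
[cite: Bloch1972Semiregularity, Remark (7.5)] [cite: Markman2025SecantWeil, §1.5] -/
theorem blochSeedsGeneric_of_pad4Seeds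
    (h : ∀ d : ℕ, 0 < d → d ≠ 1 → d ≠ 3 →
      ∃ (E₀ : AbelianVariety ℂ) (ψ₀ : E₀ ⟶ E₀) (_ : E₀.dim = 1) (_ : ψ₀ ≫ ψ₀ = -(d • 𝟙 E₀))
        (Ψ : (((E₀.prod E₀).prod (E₀.prod E₀)).prod (E₀.prod E₀)).prod (E₀.prod E₀) ⟶
          (((E₀.prod E₀).prod (E₀.prod E₀)).prod (E₀.prod E₀)).prod (E₀.prod E₀))
        (_ : Ψ = AbelianVariety.prodLift
          (AbelianVariety.fst (((E₀.prod E₀).prod (E₀.prod E₀)).prod (E₀.prod E₀)) (E₀.prod E₀) ≫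
            AbelianVariety.prodLift
              (AbelianVariety.fst ((E₀.prod E₀).prod (E₀.prod E₀)) (E₀.prod E₀) ≫
                AbelianVariety.prodLift
                  (AbelianVariety.fst (E₀.prod E₀) (E₀.prod E₀) ≫
                    AbelianVariety.prodLift (AbelianVariety.fst E₀ E₀ ≫ ψ₀) (AbelianVariety.snd E₀ E₀ ≫ (-ψ₀)))
                  (AbelianVariety.snd (E₀.prod E₀) (E₀.prod E₀) ≫
                    AbelianVariety.prodLift (AbelianVariety.fst E₀ E₀ ≫ ψ₀) (AbelianVariety.snd E₀ E₀ ≫ (-ψ₀))))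
              (AbelianVariety.snd ((E₀.prod E₀).prod (E₀.prod E₀)) (E₀.prod E₀) ≫
                AbelianVariety.prodLift (AbelianVariety.fst E₀ E₀ ≫ ψ₀) (AbelianVariety.snd E₀ E₀ ≫ (-ψ₀))))
          (AbelianVariety.snd (((E₀.prod E₀).prod (E₀.prod E₀)).prod (E₀.prod E₀)) (E₀.prod E₀) ≫
            AbelianVariety.prodLift (AbelianVariety.fst E₀ E₀ ≫ ψ₀) (AbelianVariety.snd E₀ E₀ ≫ (-ψ₀))))
        (e : ProjectiveEmbedding ((((E₀.prod E₀).prod (E₀.prod E₀)).prod (E₀.prod E₀)).prod (E₀.prod E₀)).X)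
        (a : complexBetti (projectiveSpace e.n ℂ) 2)
        (w : complexBetti ((((E₀.prod E₀).prod (E₀.prod E₀)).prod (E₀.prod E₀)).prod (E₀.prod E₀)).X (2 * 4)),
        IsRationalClass a ∧ a ≠ 0 ∧
        IsHyperbolicWeilType _ Ψ 4
          ((d : ℂ) • complexBetti.map e.ι 2 a + complexBetti.map Ψ.hom.hom.hom 2 (complexBetti.map e.ι 2 a)) ∧
        w ∈ weilClassesOf _ Ψ 4 d ∧ IsRationalClass w ∧ w ≠ 0 ∧
        HasBlochSeedAt 4 ((((E₀.prod E₀).prod (E₀.prod E₀)).prod (E₀.prod E₀)).prod (E₀.prod E₀))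
          ((d : ℂ) • complexBetti.map e.ι 2 a + complexBetti.map Ψ.hom.hom.hom 2 (complexBetti.map e.ι 2 a)) w) :
    BlochSeedsGeneric := by
  intro d hd h1 h3
  obtain ⟨E₀, ψ₀, hE, hψ, Ψ, hΨ, e, a, w, ha, ha0, hhyp, hwW, hwr, hw0, hseed⟩ := h d hd h1 h3
  exact hasHyperbolicBlochSeed_four_of_pad4Seed hd hE hψ Ψ hΨ e a ha ha0 hhyp w hwW hwr hw0 hseed

end ByName

/-! ## §3 The anchor data of the door are inhabited (every `d`, every CM datum) -/

section AnchorData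

variable {d : ℕ} {E₀ : AbelianVariety ℂ} {ψ₀ : E₀ ⟶ E₀}

/-- **The door's anchor hypotheses are inhabited for EVERY CM datum and every `d ≥ 1`**: `e`, a rational `a ≠ 0`, hyperbolicity of
`(S⁴, Ψ)` in half-dimension `4` for `h_K = d·e^*a + Ψ^*e^*a`, and a non-zero rational Weil class `w` of Hodge type `(4,4)` — the
tree's `pad4Anchor_hyperbolic_weilClass` (three applications of the aiming theorem `Motives.aimedSplitProduct_cmSquare_of_pos` to the
CM square) re-exported in the binder order of `hasHyperbolicBlochSeed_four_of_pad4Seed`; what that door still asks of a designer is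
ONLY the seed clause (for an `(e, a, w)` of their own choosing — the `e` produced here is existential and not prescribed).
[cite: Markman2025SurveySecant, §11.5 Step 2] [cite: vanGeemen1994HodgeAV, Lemma 5.2, 5.3 and 5.4 (5.4.1)] -/
theorem exists_pad4_anchorData (hd : 0 < d) (hE : E₀.dim = 1) (hψ : ψ₀ ≫ ψ₀ = -(d • 𝟙 E₀))
    (Ψ : (((E₀.prod E₀).prod (E₀.prod E₀)).prod (E₀.prod E₀)).prod (E₀.prod E₀) ⟶
      (((E₀.prod E₀).prod (E₀.prod E₀)).prod (E₀.prod E₀)).prod (E₀.prod E₀))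
    (hΨ : Ψ = AbelianVariety.prodLift
        (AbelianVariety.fst (((E₀.prod E₀).prod (E₀.prod E₀)).prod (E₀.prod E₀)) (E₀.prod E₀) ≫
          AbelianVariety.prodLift
            (AbelianVariety.fst ((E₀.prod E₀).prod (E₀.prod E₀)) (E₀.prod E₀) ≫
              AbelianVariety.prodLift
                (AbelianVariety.fst (E₀.prod E₀) (E₀.prod E₀) ≫
                  AbelianVariety.prodLift (AbelianVariety.fst E₀ E₀ ≫ ψ₀) (AbelianVariety.snd E₀ E₀ ≫ (-ψ₀)))
                (AbelianVariety.snd (E₀.prod E₀) (E₀.prod E₀) ≫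
                  AbelianVariety.prodLift (AbelianVariety.fst E₀ E₀ ≫ ψ₀) (AbelianVariety.snd E₀ E₀ ≫ (-ψ₀))))
            (AbelianVariety.snd ((E₀.prod E₀).prod (E₀.prod E₀)) (E₀.prod E₀) ≫
              AbelianVariety.prodLift (AbelianVariety.fst E₀ E₀ ≫ ψ₀) (AbelianVariety.snd E₀ E₀ ≫ (-ψ₀))))
        (AbelianVariety.snd (((E₀.prod E₀).prod (E₀.prod E₀)).prod (E₀.prod E₀)) (E₀.prod E₀) ≫
          AbelianVariety.prodLift (AbelianVariety.fst E₀ E₀ ≫ ψ₀) (AbelianVariety.snd E₀ E₀ ≫ (-ψ₀)))) :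
    ∃ (e : ProjectiveEmbedding ((((E₀.prod E₀).prod (E₀.prod E₀)).prod (E₀.prod E₀)).prod (E₀.prod E₀)).X)
      (a : complexBetti (projectiveSpace e.n ℂ) 2)
      (w : complexBetti ((((E₀.prod E₀).prod (E₀.prod E₀)).prod (E₀.prod E₀)).prod (E₀.prod E₀)).X (2 * 4)),
      IsRationalClass a ∧ a ≠ 0 ∧
      IsHyperbolicWeilType _ Ψ 4
        ((d : ℂ) • complexBetti.map e.ι 2 a + complexBetti.map Ψ.hom.hom.hom 2 (complexBetti.map e.ι 2 a)) ∧
      w ∈ weilClassesOf _ Ψ 4 d ∧ IsRationalClass w ∧ w ≠ 0 ∧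
      IsOfHodgeType (2 * 4) ((((E₀.prod E₀).prod (E₀.prod E₀)).prod (E₀.prod E₀)).prod (E₀.prod E₀)).X (2 * 4) 4 4 w := by
  obtain ⟨-, -, ⟨e, a, ha, ha0, hhyp⟩, ⟨w, hwr, hwH, hwW, hw0⟩⟩ := pad4Anchor_hyperbolic_weilClass hE hd hψ Ψ hΨ
  exact ⟨e, a, w, ha, ha0, hhyp, hwW, hwr, hw0, hwH⟩

end AnchorData

end Summit.HodgeConjecture.HodgeConjecture.Theorems

end
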